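import Mathlib
import Summits.ResolutionOfSingularities.ResolutionOfSingularities.Theorems.FrobeniusLadderFRationalResolutionCompletedBaseChangeFibreCompletion
import Summits.ResolutionOfSingularities.ResolutionOfSingularities.Theorems.FrobeniusLadderFRationalResolutionCompletedBaseChangeFibreChart
import Summits.ResolutionOfSingularities.ResolutionOfSingularities.Theorems.FrobeniusLadderFRationalResolutionBlowupChartPoints
import Literature.AlgebraicGeometry.Resolution.BlowupChartTransition

/-!
# Crux `FrobeniusLadder.FRationalResolution` (stmt-ResolutionOfSingularities-15317), line `redirect`,
# stub `stub_diagonalizableQuotientResolution` — THE TRANSPORT STEP (T) AT THE POINTS OF `Bl_{J₀Ê}(Spec Ê)`: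
# `Bl_{𝔪_z}(Spec 𝒪_{X₁,z})` is regular as soon as the point blow-up is regular at the corresponding prime of the MODEL chart

Fifth file of the (T) series. `…CompletedBaseChangeFibreCompletion.isRegular_affineBlowup_maximalIdeal_model` asked for the
regularity of the GLOBAL blowing up `Bl_𝔫(Spec T[J₀/a])` of the model chart ring at a MAXIMAL `𝔫`; a chart ring has in general
several singular points, so the usable input is LOCAL: `Bl_𝔪(Spec T[J₀/a]_𝔫)` regular, `𝔫` any prime. This file provides the
local form and carries it to the STALKS of `X₁ = Bl_{J₀Ê}(Spec Ê)` (`Ê = (T_𝔳)^`), i.e. produces the hypothesis `hloc` of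
`…SingularPointsFinite.hloc_of_maximalIdealPow_then_finite_singularPoints` / `…MaximalIdealTower` point by point from the model:
* `isRegular_affineBlowup_maximalIdeal_of_ringEquiv_adicCompletion_local` — LOCAL form of
  `…PointBlowupOfCompletion.isRegular_affineBlowup_maximalIdeal_of_ringEquiv_adicCompletion`: `B` of finite type over a field,
  `𝔮` a PRIME, `Bl_𝔪(Spec B_𝔮)` regular, `𝒪̂ ≅ (B_𝔮)^` ⇒ `Bl_𝔪(Spec 𝒪)` regular (G-ring ascent `B_𝔮 → (B_𝔮)^`, transport, faithfully
  flat descent);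
* ★★ `isRegular_affineBlowup_maximalIdeal_model_local` — presented base change `Θ : C ⊗_T Ê ≅ C'` (`C` of finite type over
  `T`, e.g. `T[J₀/a]`; `C'` e.g. `Ê[J₀Ê/a]`), `𝔑'` a prime of `C'` over `V(𝔳C)`: `Bl_𝔪(Spec C_{ψ⁻¹𝔑'})` regular ⇒
  `Bl_𝔪(Spec C'_{𝔑'})` regular;
* `isRegular_affineBlowup_maximalIdeal_of_ringEquiv` — transport of `Bl_𝔪`-regularity along a ring isomorphism of local rings;
* ★★ `exists_chart_prime_ringEquiv_stalk` — points of `Bl_I(Spec R)` via the chart rings WITH THE STALK: for `p ∈ Bl_I(Spec R)` a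
  chart index `i`, a prime `𝔔` of `R[I/x_i]` with `𝔔 ∩ R = π(p)`, «regular iff regular», AND a ring isomorphism
  `𝒪_{Bl,p} ≅ R[I/x_i]_𝔔` (the tree's `…BlowupChartPoints.exists_chart_point_prime` exposes only the former);
* ★★★ **`hloc_stalk_of_charts` / `hloc_stalk_of_model_charts`** — `T` of finite type over a field `K`, `B` a Noetherian flat
  `T`-algebra with `B = T + 𝔳B`, resp. `𝔳` maximal and `B = Ê = (T_𝔳)^`; `J₀ = (x₁, …, x_n) ⊆ T`,
  `X₁ = Bl_{J₀Ê}(Spec Ê)`: if for every `i` and every prime `𝔫 ⊇ 𝔳 T[J₀/x_i]` of the model chart ring with `T[J₀/x_i]_𝔫` NOT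
  regular the point blow-up `Bl_𝔪(Spec T[J₀/x_i]_𝔫)` is regular, then **for every point `z` of `X₁` over `V(𝔪̂)` with `𝒪_{X₁,z}`
  not regular, `Bl_{𝔪_z}(Spec 𝒪_{X₁,z})` is regular** — the `hloc` input, in the model presentation `Ê = (T_𝔳)^`.
What remains of (T): the finiteness input `hfin` at scheme level (chartwise it is `…Chart.finite_not_isRegularLocalRing_model_chart`;
the points of `X₁` inject into the chart primes by `…BlowupChartPoints.exists_chart_point_prime`) and the passage from the model
presentation `(T_𝔳)^` to the Galois presentation `((B ⊗_K K')_{𝔔'})^` of the consumers along the ring isomorphism of g19/g20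
(`…MonomialAlgebraCompletion`, `…FixedPointCompletionChart`).

Honest label: plumbing toward ONE leaf stub (no stub, crux or summit closed). No definitions, no named facts, no sorry.
[cite: Matsumura1987, Thm. 8.14; Thm. 23.7; §32, Cor. of Thm. 32.6] [cite: StacksProject, Tag 0804; Tag 0805]
[cite: GortzWedhorn2020, Prop. 13.91 (2); (13.19) p. 415]
-/

noncomputable section

-- single-problem summit: the doubled namespace component is forced
set_option linter.dupNamespace false

open IsLocalRing AlgebraicGeometry CategoryTheory
open scoped TensorProduct
open Literature.AlgebraicGeometry.Resolution

namespace Summit.ResolutionOfSingularities.ResolutionOfSingularities.Theorems.FRationalResolution.CompletedBaseChangeFibrePoints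

/-! ## §1 The local form of `Bl_𝔪`-regularity transfer through the completion -/

/-- **LOCAL form**: `B` of finite type over a field, `𝔮` a prime with `Bl_𝔪(Spec B_𝔮)` regular, `𝒪` Noetherian local with
`(B_𝔮)^ ≅ 𝒪̂` ⇒ `Bl_𝔪(Spec 𝒪)` regular. [cite: Matsumura1987, Thm. 8.14; Thm. 23.7; §32, Cor. of Thm. 32.6]
[cite: GortzWedhorn2020, Prop. 13.91 (2)] -/
theorem isRegular_affineBlowup_maximalIdeal_of_ringEquiv_adicCompletion_local (K : Type) [Field K] {B : Type} [CommRing B]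
    [Algebra K B] [Algebra.FiniteType K B] (𝔮 : Ideal B) [𝔮.IsPrime]
    (hreg : Scheme.IsRegular (affineBlowup (maximalIdeal (Localization.AtPrime 𝔮))))
    {𝒪 : Type} [CommRing 𝒪] [IsNoetherianRing 𝒪] [IsLocalRing 𝒪]
    (e : AdicCompletion (maximalIdeal (Localization.AtPrime 𝔮)) (Localization.AtPrime 𝔮) ≃+* AdicCompletion (maximalIdeal 𝒪) 𝒪) :
    Scheme.IsRegular (affineBlowup (maximalIdeal 𝒪)) := by
  have hB : IsGRing B := Matsumura1987_32_6_cor_holds.{0} K B ‹_›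
  haveI : IsNoetherianRing B := hB.1
  haveI : IsNoetherianRing (Localization.AtPrime 𝔮) :=
    IsLocalization.isNoetherianRing 𝔮.primeCompl (Localization.AtPrime 𝔮) inferInstance
  -- ascend `B_𝔮 → (B_𝔮)^`
  have hreg' : Scheme.IsRegular (affineBlowup (𝔮.map (algebraMap B (Localization.AtPrime 𝔮)))) := by
    rwa [Localization.AtPrime.map_eq_maximalIdeal]
  have h1 := BlowupRegularCompletionAscent.isRegular_affineBlowup_adicCompletion_of_isGRing hB 𝔮 𝔮 hreg'
  rw [Localization.AtPrime.map_eq_maximalIdeal, ← AdicCompletion.maximalIdeal_eq_map] at h1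
  -- transport along `e`
  have h2 := BlowupOrbitCentre.isRegular_affineBlowup_map_of_ringEquiv e _ h1
  rw [PointBlowupOfCompletion.map_maximalIdeal_ringEquiv e, AdicCompletion.maximalIdeal_eq_map] at h2
  -- descend `𝒪 → 𝒪̂`
  exact BlowupRegularFlatChart.isRegular_affineBlowup_of_adicCompletion (maximalIdeal 𝒪) h2

/-- ★★ **MODEL FORM, local.** `T` of finite type over a field `K`, `𝔳 ⊆ T` maximal, `Ê = (T_𝔳)^`, `C` of finite type over `T`,
`ψ : C → C'` (`C'` Noetherian) presented as the base change by `Θ : C ⊗_T Ê ≅ C'`, `Θ(c ⊗ 1) = ψ c`, `𝔑'` a prime of `C'` over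
`V(𝔳C)`: if `Bl_𝔪(Spec C_{ψ⁻¹𝔑'})` is regular then `Bl_𝔪(Spec C'_{𝔑'})` is regular.
[cite: Matsumura1987, Thm. 8.14; Thm. 23.7] [cite: StacksProject, Tag 0805] -/
theorem isRegular_affineBlowup_maximalIdeal_model_local (K : Type) [Field K] (T : Type) [CommRing T] [Algebra K T]
    [Algebra.FiniteType K T] (𝔳 : Ideal T) [𝔳.IsMaximal]
    (C : Type) [CommRing C] [Algebra T C] [Algebra.FiniteType T C] (C' : Type) [CommRing C'] [IsNoetherianRing C']
    (ψ : C →+* C')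
    (Θ : C ⊗[T] AdicCompletion (maximalIdeal (Localization.AtPrime 𝔳)) (Localization.AtPrime 𝔳) ≃+* C')
    (hΘ : ∀ c : C, Θ (algebraMap C _ c) = ψ c)
    (𝔑' : Ideal C') [𝔑'.IsPrime] (h𝔑' : 𝔳.map (algebraMap T C) ≤ 𝔑'.comap ψ)
    (hreg : Scheme.IsRegular (affineBlowup (maximalIdeal (Localization.AtPrime (𝔑'.comap ψ))))) :
    Scheme.IsRegular (affineBlowup (maximalIdeal (Localization.AtPrime 𝔑'))) := by
  haveI : IsNoetherianRing T := Algebra.FiniteType.isNoetherianRing K T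
  haveI : IsNoetherianRing (Localization.AtPrime 𝔑') :=
    IsLocalization.isNoetherianRing 𝔑'.primeCompl (Localization.AtPrime 𝔑') inferInstance
  letI : Algebra K C := ((algebraMap T C).comp (algebraMap K T)).toAlgebra
  haveI : IsScalarTower K T C := IsScalarTower.of_algebraMap_eq (fun _ => rfl)
  haveI : Algebra.FiniteType K C := Algebra.FiniteType.trans (S := T) inferInstance inferInstance
  haveI := CompletedBaseChangeFibreFlat.flat_adicCompletion_atPrime T 𝔳
  obtain ⟨ê, -⟩ := CompletedBaseChangeFibreCompletion.exists_ringEquiv_adicCompletion_of_presentation 𝔳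
    (CompletedBaseChangeFibreFlat.forall_exists_sub_mem_adicCompletion_atPrime T 𝔳) ψ Θ hΘ 𝔑' h𝔑'
  exact isRegular_affineBlowup_maximalIdeal_of_ringEquiv_adicCompletion_local K _ hreg ê

/-- **`Bl_𝔪`-regularity is invariant under ring isomorphisms of local rings.** [folklore] -/
theorem isRegular_affineBlowup_maximalIdeal_of_ringEquiv {R S : Type} [CommRing R] [CommRing S] [IsLocalRing R]
    [IsLocalRing S] (e : R ≃+* S) (hreg : Scheme.IsRegular (affineBlowup (maximalIdeal R))) :
    Scheme.IsRegular (affineBlowup (maximalIdeal S)) := by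
  have h := BlowupOrbitCentre.isRegular_affineBlowup_map_of_ringEquiv e _ hreg
  rwa [PointBlowupOfCompletion.map_maximalIdeal_ringEquiv e] at h

/-! ## §2 Points of `Bl_I(Spec R)` via the chart rings, with the stalk -/

/-- Localizations at corresponding primes along a ring isomorphism are isomorphic (compatibly with the structure maps).
[folklore] -/
theorem nonempty_ringEquiv_localization_of_ringEquiv {S S' : Type} [CommRing S] [CommRing S'] (e : S ≃+* S')
    (P : Ideal S) [P.IsPrime] (𝔔 : Ideal S') [𝔔.IsPrime] (hP : ∀ s, s ∈ P ↔ e s ∈ 𝔔) :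
    Nonempty (Localization.AtPrime P ≃+* Localization.AtPrime 𝔔) := by
  have H : Submonoid.map e.toMonoidHom P.primeCompl = 𝔔.primeCompl := by
    ext t
    constructor
    · rintro ⟨s, hs, rfl⟩
      exact fun ht => hs ((hP s).mpr ht)
    · intro ht
      refine ⟨e.symm t, fun hs => ht ?_, by simp⟩
      have := (hP _).mp hs
      rwa [RingEquiv.apply_symm_apply] at this
  exact ⟨IsLocalization.ringEquivOfRingEquiv (Localization.AtPrime P) (Localization.AtPrime 𝔔) e H⟩

/-- ★★ **Points of `Bl_I(Spec R)` via the chart rings, WITH THE STALK ISOMORPHISM**: for `R` Noetherian, a generating family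
`x_i` of `I` and `p ∈ Bl_I(Spec R)` there are `i`, a prime `𝔔` of `R[I/x_i]` with `𝔔 ∩ R = π(p)`, and a ring isomorphism
`𝒪_{Bl_I(Spec R), p} ≅ R[I/x_i]_𝔔`. [cite: StacksProject, Tag 0804] [cite: GortzWedhorn2020, (13.19) p. 415] -/
theorem exists_chart_prime_ringEquiv_stalk {R : Type} [CommRing R] (I : Ideal R) [IsNoetherianRing R] {ι : Type*}
    (x : ι → R) (hxI : ∀ i, x i ∈ I) (hI : I ≤ Ideal.span (Set.range x)) (p : affineBlowup I) :
    ∃ (i : ι) (𝔔 : Ideal (blowupAlgebra I (x i))) (_ : 𝔔.IsPrime),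
      𝔔.comap (algebraMap R (blowupAlgebra I (x i))) = (affineBlowup.π I p).asIdeal ∧
      (IsRegularLocalRing ((affineBlowup I).presheaf.stalk p) ↔ IsRegularLocalRing (Localization.AtPrime 𝔔)) ∧
      Nonempty ((affineBlowup I).presheaf.stalk p ≃+* Localization.AtPrime 𝔔) := by
  classical
  obtain ⟨i, q, 𝔔, h𝔔, hq, hmemq, hcomap, hiff⟩ := BlowupChartPoints.exists_chart_point_prime I x hxI hI p
  refine ⟨i, 𝔔, h𝔔, hcomap, hiff, ?_⟩
  subst hq
  -- stalk at `awayι q` ≅ stalk of the chart at `q` (open immersion)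
  let e₁ : (affineBlowup I).presheaf.stalk
      (Proj.awayι (reesGrading I) (reesT (x i) (hxI i)) (reesT_mem (x i) (hxI i)) one_pos q) ≃+*
      (Spec (.of (HomogeneousLocalization.Away (reesGrading I) (reesT (x i) (hxI i))))).presheaf.stalk q :=
    (asIso ((Proj.awayι (reesGrading I) (reesT (x i) (hxI i)) (reesT_mem (x i) (hxI i)) one_pos).stalkMap q)).commRingCatIsoToRingEquiv
  -- stalk of `Spec` at `q` ≅ localization
  letI : Algebra (HomogeneousLocalization.Away (reesGrading I) (reesT (x i) (hxI i)))
      ((Spec (.of (HomogeneousLocalization.Away (reesGrading I) (reesT (x i) (hxI i))))).presheaf.stalk q) :=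
    (StructureSheaf.toStalk _ q).hom.toAlgebra
  have hloc : IsLocalization.AtPrime
      ((Spec (.of (HomogeneousLocalization.Away (reesGrading I) (reesT (x i) (hxI i))))).presheaf.stalk q)
      q.asIdeal := StructureSheaf.IsLocalization.to_stalk _ q
  let e₂ := (IsLocalization.algEquiv q.asIdeal.primeCompl
    ((Spec (.of (HomogeneousLocalization.Away (reesGrading I) (reesT (x i) (hxI i))))).presheaf.stalk q)
    (Localization.AtPrime q.asIdeal)).toRingEquiv
  -- localizations at `q` and `𝔔` along `reesChartEquiv`
  obtain ⟨e₃⟩ := nonempty_ringEquiv_localization_of_ringEquiv (reesChartEquiv (I := I) (x i) (hxI i)) q.asIdeal 𝔔 hmemq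
  exact ⟨(e₁.trans e₂).trans e₃⟩

/-! ## §3 `hloc` at the points of `Bl_{J₀B}(Spec B)` from the model charts -/

/-- ★★★ **`hloc` AT THE POINTS OF `X₁ = Bl_{J₀B}(Spec B)` FROM THE MODEL CHARTS (generic base change).** Let `T` be of finite type
over a field `K`, `𝔳 ⊆ T` an ideal, `B` a Noetherian FLAT `T`-algebra with `B = T + 𝔳B` (e.g. `B = (T_𝔳)^` for `𝔳` maximal),
`J₀ ⊆ T` generated by `x₁, …, x_n`. Suppose that for every `i` and every prime `𝔫 ⊇ 𝔳 T[J₀/x_i]` of the model chart ring with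
`T[J₀/x_i]_𝔫` not regular, `Bl_𝔪(Spec T[J₀/x_i]_𝔫)` is regular. Then for every point `z` of `X₁` over `V(𝔳B)` whose local ring is
not regular, `Bl_{𝔪_z}(Spec 𝒪_{X₁,z})` is regular. [cite: Matsumura1987, Thm. 8.14; Thm. 23.7] [cite: StacksProject, Tag 0804; Tag 0805]
[cite: GortzWedhorn2020, Prop. 13.91 (2)] -/
theorem hloc_stalk_of_charts (K : Type) [Field K] (T : Type) [CommRing T] [Algebra K T] [Algebra.FiniteType K T]
    (𝔳 : Ideal T) (B : Type) [CommRing B] [Algebra T B] [IsNoetherianRing B] [Module.Flat T B]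
    (hres : ∀ b : B, ∃ t : T, b - algebraMap T B t ∈ 𝔳.map (algebraMap T B))
    {n : ℕ} (x : Fin n → T) (J₀ : Ideal T) (hJ₀ : J₀ = Ideal.span (Set.range x))
    (hmodel : ∀ (i : Fin n) (𝔫 : PrimeSpectrum (blowupAlgebra J₀ (x i))),
      𝔳.map (algebraMap T (blowupAlgebra J₀ (x i))) ≤ 𝔫.asIdeal →
      ¬ IsRegularLocalRing (Localization.AtPrime 𝔫.asIdeal) →
      Scheme.IsRegular (affineBlowup (R := Localization.AtPrime 𝔫.asIdeal)
        (maximalIdeal (Localization.AtPrime 𝔫.asIdeal))))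
    (z : affineBlowup (J₀.map (algebraMap T B)))
    (hz𝔳 : 𝔳 ≤ (affineBlowup.π (J₀.map (algebraMap T B)) z).asIdeal.comap (algebraMap T B))
    (hz : ¬ IsRegularLocalRing ((affineBlowup (J₀.map (algebraMap T B))).presheaf.stalk z)) :
    Scheme.IsRegular (affineBlowup (R := (affineBlowup (J₀.map (algebraMap T B))).presheaf.stalk z)
      (maximalIdeal ((affineBlowup (J₀.map (algebraMap T B))).presheaf.stalk z))) := by
  haveI : IsNoetherianRing T := Algebra.FiniteType.isNoetherianRing K T
  -- the chart containing `z`, its prime and the stalk isomorphism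
  have hxJ : ∀ i, algebraMap T B (x i) ∈ J₀.map (algebraMap T B) := fun i =>
    Ideal.mem_map_of_mem _ (hJ₀ ▸ Ideal.subset_span ⟨i, rfl⟩)
  have hJle : J₀.map (algebraMap T B) ≤ Ideal.span (Set.range fun i => algebraMap T B (x i)) := by
    rw [hJ₀, Ideal.map_span, ← Set.range_comp]
    exact le_rfl
  obtain ⟨i, 𝔑', h𝔑'p, hcomap, hiff, ⟨e⟩⟩ :=
    exists_chart_prime_ringEquiv_stalk (J₀.map (algebraMap T B)) (fun i => algebraMap T B (x i)) hxJ hJle z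
  haveI := h𝔑'p
  haveI : IsNoetherianRing (blowupAlgebra J₀ (x i)) := isNoetherianRing_blowupAlgebra_of_isNoetherianRing J₀ (x i)
  haveI : IsNoetherianRing (blowupAlgebra (J₀.map (algebraMap T B)) (algebraMap T B (x i))) :=
    isNoetherianRing_blowupAlgebra_of_isNoetherianRing (J₀.map (algebraMap T B)) (algebraMap T B (x i))
  haveI : Algebra.FiniteType T (blowupAlgebra J₀ (x i)) := finiteType_blowupAlgebra J₀ (x i) (IsNoetherian.noetherian J₀)
  letI : Algebra K (blowupAlgebra J₀ (x i)) := ((algebraMap T (blowupAlgebra J₀ (x i))).comp (algebraMap K T)).toAlgebra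
  haveI : IsScalarTower K T (blowupAlgebra J₀ (x i)) := IsScalarTower.of_algebraMap_eq (fun _ => rfl)
  haveI : Algebra.FiniteType K (blowupAlgebra J₀ (x i)) := Algebra.FiniteType.trans (S := T) inferInstance inferInstance
  haveI : IsNoetherianRing (Localization.AtPrime 𝔑') :=
    IsLocalization.isNoetherianRing 𝔑'.primeCompl (Localization.AtPrime 𝔑') inferInstance
  obtain ⟨Θ, hΘ, -⟩ := CompletedBaseChangeFibreChart.exists_ringEquiv_tensor_blowupAlgebra J₀ (J₀.map (algebraMap T B))
    (x i) le_rfl le_rfl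
  -- `𝔫 = ψ⁻¹ 𝔑'` lies over `𝔳`
  have h𝔫 : 𝔳.map (algebraMap T (blowupAlgebra J₀ (x i))) ≤
      𝔑'.comap (blowupAlgebraMap (algebraMap T B) J₀ (J₀.map (algebraMap T B)) (x i) le_rfl) := by
    rw [Ideal.map_le_iff_le_comap, Ideal.comap_comap, blowupAlgebraMap_comp_algebraMap, ← Ideal.comap_comap, hcomap]
    exact hz𝔳
  -- the model prime is singular, so the model hypothesis applies
  have hnot : ¬ IsRegularLocalRing (Localization.AtPrime
      (𝔑'.comap (blowupAlgebraMap (algebraMap T B) J₀ (J₀.map (algebraMap T B)) (x i) le_rfl))) := by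
    intro h
    apply hz
    exact hiff.mpr ((CompletedBaseChangeFibreChart.isRegularLocalRing_iff_blowupAlgebra J₀ (J₀.map (algebraMap T B)) (x i)
      le_rfl le_rfl 𝔳 hres 𝔑' h𝔫).mp h)
  have hreg𝔫 := hmodel i ⟨𝔑'.comap (blowupAlgebraMap (algebraMap T B) J₀ (J₀.map (algebraMap T B)) (x i) le_rfl),
    inferInstance⟩ h𝔫 hnot
  -- transfer: completion of the model chart local ring ≅ completion of `C'_{𝔑'}`, then to the stalk
  obtain ⟨ê, -⟩ := CompletedBaseChangeFibreCompletion.exists_ringEquiv_adicCompletion_of_presentation (B := B) 𝔳 hres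
    (blowupAlgebraMap (algebraMap T B) J₀ (J₀.map (algebraMap T B)) (x i) le_rfl) Θ hΘ 𝔑' h𝔫
  have hreg𝔑' := isRegular_affineBlowup_maximalIdeal_of_ringEquiv_adicCompletion_local K _ hreg𝔫 ê
  exact isRegular_affineBlowup_maximalIdeal_of_ringEquiv (R := Localization.AtPrime 𝔑')
    (S := (affineBlowup (J₀.map (algebraMap T B))).presheaf.stalk z) e.symm hreg𝔑'

/-- ★★★ **`hloc` AT THE POINTS OF `X₁ = Bl_{J₀Ê}(Spec Ê)`, `Ê = (T_𝔳)^`, FROM THE MODEL CHARTS.** As `hloc_stalk_of_charts` with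
`B = (T_𝔳)^`, `𝔳` maximal — all base-change hypotheses discharged (`…CompletedBaseChangeFibreFlat` §4): if the point blow-up is
regular at every non-regular prime over `𝔳` of every model chart ring `T[J₀/x_i]`, then `Bl_{𝔪_z}(Spec 𝒪_{X₁,z})` is regular at every
point `z` of `X₁` over `V(𝔪̂)` with non-regular local ring — the `hloc` input of the two-step recipes in the model presentation.
[cite: Matsumura1987, Thm. 8.14; Thm. 23.7] [cite: StacksProject, Tag 0804; Tag 0805] [cite: GortzWedhorn2020, Prop. 13.91 (2)] -/
theorem hloc_stalk_of_model_charts (K : Type) [Field K] (T : Type) [CommRing T] [Algebra K T] [Algebra.FiniteType K T]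
    (𝔳 : Ideal T) [𝔳.IsMaximal] {n : ℕ} (x : Fin n → T) (J₀ : Ideal T) (hJ₀ : J₀ = Ideal.span (Set.range x))
    (hmodel : ∀ (i : Fin n) (𝔫 : PrimeSpectrum (blowupAlgebra J₀ (x i))),
      𝔳.map (algebraMap T (blowupAlgebra J₀ (x i))) ≤ 𝔫.asIdeal →
      ¬ IsRegularLocalRing (Localization.AtPrime 𝔫.asIdeal) →
      Scheme.IsRegular (affineBlowup (R := Localization.AtPrime 𝔫.asIdeal)
        (maximalIdeal (Localization.AtPrime 𝔫.asIdeal))))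
    (z : affineBlowup (J₀.map (algebraMap T (AdicCompletion (maximalIdeal (Localization.AtPrime 𝔳)) (Localization.AtPrime 𝔳)))))
    (hz𝔳 : 𝔳 ≤ (affineBlowup.π (J₀.map (algebraMap T
      (AdicCompletion (maximalIdeal (Localization.AtPrime 𝔳)) (Localization.AtPrime 𝔳)))) z).asIdeal.comap (algebraMap T _))
    (hz : ¬ IsRegularLocalRing ((affineBlowup (J₀.map (algebraMap T
      (AdicCompletion (maximalIdeal (Localization.AtPrime 𝔳)) (Localization.AtPrime 𝔳))))).presheaf.stalk z)) :
    Scheme.IsRegular (affineBlowup (R := (affineBlowup (J₀.map (algebraMap T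
        (AdicCompletion (maximalIdeal (Localization.AtPrime 𝔳)) (Localization.AtPrime 𝔳))))).presheaf.stalk z)
      (maximalIdeal ((affineBlowup (J₀.map (algebraMap T
        (AdicCompletion (maximalIdeal (Localization.AtPrime 𝔳)) (Localization.AtPrime 𝔳))))).presheaf.stalk z))) := by
  haveI : IsNoetherianRing T := Algebra.FiniteType.isNoetherianRing K T
  haveI : IsNoetherianRing (Localization.AtPrime 𝔳) :=
    IsLocalization.isNoetherianRing 𝔳.primeCompl (Localization.AtPrime 𝔳) inferInstance
  haveI : IsNoetherianRing (AdicCompletion (maximalIdeal (Localization.AtPrime 𝔳)) (Localization.AtPrime 𝔳)) :=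
    isNoetherianRing_adicCompletion_maximalIdeal _
  haveI := CompletedBaseChangeFibreFlat.flat_adicCompletion_atPrime T 𝔳
  exact hloc_stalk_of_charts K T 𝔳 _ (CompletedBaseChangeFibreFlat.forall_exists_sub_mem_adicCompletion_atPrime T 𝔳)
    x J₀ hJ₀ hmodel z hz𝔳 hz

end Summit.ResolutionOfSingularities.ResolutionOfSingularities.Theorems.FRationalResolution.CompletedBaseChangeFibrePoints

end
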